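import Summits.PneNP.PneNP.Theses.ConvexRankGates
import Literature.Computability.Complexity.ExtMonotoneCliqueGate
import Literature.Computability.Complexity.CircuitClassesProofs
import Summits.PneNP.PneNP.Theorems.LinAlgGateBlind.Negative.OnePermGate
import Summits.PneNP.PneNP.Theorems.LinAlgGateBlind.Negative.DetGate
import Summits.PneNP.PneNP.Theorems.LinAlgGateBlind.Negative.CliquePolyDetRepr

/-!
# Line `invariant-module-linearisation` — crux `ConvexRankGates.LinAlgGateBlind` (stmt-PneNP-10681)

Skeleton of the line (crux-plan, planner-cruxplan-stmt-PneNP-10681-invariant-module-lin-0,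
2026-08-16) for the triaged crux idea `invariant-module-linearisation` (crux-ideate r1, ideator 2;
triage r1: 3 × pass, sharpenings of TRIAGE-r1-1, r1-2, r1-3 built in, see the line card
`Lines/invariant-module-linearisation.md`).

THE CRUX (`Blind` below, `linAlgGateBlind_iff` by `Iff.rfl`). `∃ δ ∈ (0,1/2) ∀ c ∀ᶠ m`: no circuit
with `≤ m^c` gates over `{∧₂, ∨₂} ∪ PERM_{m^c} ∪ GRANK_{m^c}` computes `CLIQUE(m, ⌈m^δ⌉₊)`;
PERM = membership of a fixed permutation in the group generated by the switched-on permutations of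
`≤ s` points (`IsPermGate`), GRANK = generic-rank threshold of an affine symbolic matrix of
dimension `≤ s` over any field (`IsGRankGate`).

THE LINE. PERM gates are the only NONABELIAN ingredient of the crux. The fixed-vector criterion
(`τ ∈ K ⇒ Fix_W(K) ⊆ Fix_W(τ)` for every module `W` of a group containing `K` and `τ`) turns group
generation — the one non-polymatroidal operation in the basis — into INTERSECTION of fixed spaces,
and each test `[Fix_W(H_X) ⊆ Fix_W(π)]` is, by annihilator duality, ONE monotone span program over
the ring of `W`. So IF polynomially many modules of polynomial total dimension decide membership
(the LINEARISATION CONJECTURE, stub A — typed here, after TRIAGE-r1-3, with modules of SECTION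
NORMALISERS `L_j ≤ Sym(d)` over the rings `ℤ/q` and the GUARDED test `H_X ≤ L_j → Fix ⊆ Fix`, because
the `Sym(d)`-module version is false: hooks of degree `C(d-1, d/2-1)`; rings `ℤ/p^k` rather than prime
fields because abelian `p`-sections of exponent `p^k` — the Lichter motive `(ℤ/4)^t ↪ Sym(4t)` of
TRIAGE-r1-2 (ii) — are then decided by ONE affine test, so the conjecture's open content is purely
nonabelian), then every PERM gate is, inside
the circuit, a polynomial `∧`-tree of SPAN gates (stub B: tests → span gates, linear duality;
stub C: gate-by-gate rebasing of the circuit, `Circuit.rebase'` of the tree — both STANDALONE lemmas with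
explicit bounds, the polynomial uniformity being proved here: `permSpanSim_of`, `permElim_of`), and the
crux FOLLOWS from
— indeed becomes EQUIVALENT to — its abelian shadow: blindness of `{∧₂, ∨₂} ∪ SPAN_{m^c} ∪ GRANK_{m^c}`
circuits (stub D, `LinBlind`), the statement for which single-device lower-bound technology exists
(Gál's rank measure, Nullstellensatz/PR18 lifting, one characteristic per gate) and at which the two
sibling lines `dnf-invariant-wide-gates-see-small-cliques` (one-sided `SG` ⇒ blindness, a reduction
indifferent to the basis growing from PERM to SPAN since `SPAN∘OR ⊆ SPAN`) and
`perm-door-lifted-closure-programs` (abelian, one field) are aimed BY THEIR OWN SCOPE. This file makes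
that division of labour a kernel-checked implication: `LinAlgGateBlind_of`.

NEW GATE CLASS (inlined in every registered signature, named `IsSpanGate` below): SPAN_s = monotone
span programs over a ring `ℤ/q`, `2 ≤ q ≤ s`, of dimension `D ≤ s`, one vector per argument position
(an input owning several rows = several positions wired to the same input; `Gate.args` is not
injective), accepting `v` iff the target `t` lies in the `ℤ/q`-span of the switched-on vectors
(Karchmer–Wigderson 1993; Krajíček 2019 §18.3; the crux's own gloss "abelian case = monotone span
programs over `ℤ/q`"). By CRT a `ℤ/q`-gate is the `∧` of its `ℤ/p^k`-gates; an `𝔽_{p^r}`-program of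
dimension `D` is an `𝔽_p`-program of dimension `rD`; a characteristic-0 test on a module of a finite
group `L ≤ Sym(d)` has the same outcome over `𝔽_p` for any prime `p ∈ (d, 2d]` (`p ∤ |L|`, fixed points
of a `ℤ_(p)`-lattice reduce exactly) — so nothing representation-theoretic is lost by the typing.
`SPAN_s ⊆ PERM_{s²}` (`(ℤ/q)^D ↪ Sym(qD)` by `D` disjoint `q`-cycles, span = generated subgroup;
PROVED below, `IsSpanGate.isPermGate`), and conversely every PERM gate whose permutations COMMUTE is an
`∧` of `≤ π(s)` SPAN_{s+1} gates (primary decomposition + the affine module `Γ_p ⊕ ℤ/p^k`,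
`u·(x, c) = (x, c + ⟨u, x⟩)`, exact by the double-annihilator property of the quasi-Frobenius ring
`ℤ/p^k` — the abelian instance of stub A): stub D is, up to `c ↦ O(c)`, EXACTLY THE CRUX FOR ABELIAN
PERM GATES, it is IMPLIED by the crux (`linBlind_of_linAlgGateBlind`), and modulo stubs A–C the line is
an equivalence (`linAlgGateBlind_iff_linBlind`).

## Disproof used (`Cruxes/LinAlgGateBlind/Disproof.lean`, gen 2, 1359 lines, rc 0, 0 sorry; read 2026-08-16)
* `not_withoutBasis`, `not_withoutSizeBound` — HONOURED: stub D keeps `C.IsOver (linBasis (m^c))`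
  and `C.size ≤ m^c`; the composition USES the size bound (rebasing multiplies size by a polynomial).
* `not_withoutPermDim` / `not_blindPermOnly_pow_kOf` (ONE permutation gate on `m^{k+3}` points computes
  CLIQUE; landed: `Negative.OnePermGate.exists_onePermGate_computes_cliqueFn`, imported here) — HONOURED
  and USED: the line uses `d ≤ s` at stub B/C (the span dimension is polynomial in the number `d` of
  points: `(n + d + 2)^a`), so the one-gate PERM construction becomes a SPAN gate of dimension
  `m^{Θ(k)}`, outside `linBasis (m^c)` — no stub is an instance it refutes.
* `not_withoutGRankDim` / `not_blindDim_pow_kOf` / headline `dc_cliquePoly_superpolynomial_of_linAlgGateBlind`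
  (landed: `Negative.DetGate`, `Negative.CliquePolyDetRepr`, imported) — HONOURED: GRANK is carried
  UNCHANGED into stub D with its bound `d ≤ m^c`; CONSEQUENCE recorded honestly: stub D inherits the
  Valiant calibration verbatim (`not_linBlindWithoutGRankDim` below re-proves the one-gate kill for the
  linear basis from the landed Negative lemmas), i.e. this line removes the nonabelian group theory from
  crux #4 and nothing else; the GRANK half stays ≥ VNP ⊄ VBP until the planner re-types GRANK.
* `not_blindConstK`, `not_uniformThreshold`, `blind_window` — HONOURED: stub D has the crux's quantifier
  shape `∃ δ ∈ (0,1/2) ∀ c ∀ᶠ m` and `k = ⌈m^δ⌉₊ → ∞` verbatim.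
* `not_blind_of_oneLinGate` — the cheap-kill vector (one wild GRANK gate) is unchanged by this line.
* Targets `Sketch3Copy.not_shadowCliqueCover` — not this line's lemma (ideator 3).

No `sorry` outside the four registered `stub_*`; `LinAlgGateBlind_of` concludes the crux BY NAME.
-/

set_option linter.dupNamespace false

namespace Summit.PneNP.PneNP.Cruxes.LinAlgGateBlind.InvariantModuleLinearisation

open Literature.Computability.Complexity Filter

/-! ## The new gate class and the three bases -/

/-- **SPAN gates** (monotone span programs over a ring `ℤ/q`, size parameter `≤ s`): there are a
modulus `2 ≤ q ≤ s`, a dimension `D ≤ s`, one vector `wᵢ ∈ (ℤ/q)^D` per argument position and a target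
`t ∈ (ℤ/q)^D` such that `g v = 1 ↔ t ∈ span_{ℤ/q} {wᵢ | vᵢ = 1}` (Karchmer–Wigderson 1993; Krajíček
2019, §18.3). The abelian shadow of `IsPermGate` (`(ℤ/q)^D ↪ Sym(q·D)`, `IsSpanGate.isPermGate`). -/
def IsSpanGate (s : ℕ) (g : GateFn) : Prop :=
  ∃ q D : ℕ, 2 ≤ q ∧ q ≤ s ∧ D ≤ s ∧
    ∃ (w : Fin g.1 → Fin D → ZMod q) (t : Fin D → ZMod q),
      ∀ v : Fin g.1 → Bool, g.2 v = true ↔ t ∈ Submodule.span (ZMod q) (w '' {i | v i = true})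

/-- The crux's wide gates `Lin s = PERM_s ∪ GRANK_s` (texts of `IsPermGate`/`IsGRankGate` are literally
the route file's inline `let`). -/
def Lin (s : ℕ) : Set GateFn := {g | IsPermGate s g ∨ IsGRankGate s g}

/-- The crux's basis `{∧₂, ∨₂} ∪ PERM_s ∪ GRANK_s`. -/
def basis (s : ℕ) : Set GateFn := {GateFn.and 2, GateFn.or 2} ∪ Lin s

/-- The ABELIANISED ("linear") basis `{∧₂, ∨₂} ∪ SPAN_s ∪ GRANK_s` of stub D. -/
def linBasis (s : ℕ) : Set GateFn := {GateFn.and 2, GateFn.or 2} ∪ {g | IsSpanGate s g ∨ IsGRankGate s g}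

/-- The basis `{∧₂, ∨₂} ∪ SPAN_s` into which ONE PERM gate is rewritten (stub B). -/
def spanBasis (s : ℕ) : Set GateFn := {GateFn.and 2, GateFn.or 2} ∪ {g | IsSpanGate s g}

/-! ## The crux, read back -/

/-- `k = ⌈m^δ⌉₊`. -/
noncomputable def kOf (δ : ℝ) (m : ℕ) : ℕ := ⌈(m : ℝ) ^ δ⌉₊

/-- Blindness of a basis family `B : ℕ → Set GateFn` at exponent `δ`: for every `c`, eventually in
`m`, no `B (m^c)`-circuit with `≤ m^c` gates computes `CLIQUE(m, ⌈m^δ⌉₊)`. -/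
def BlindFor (B : ℕ → Set GateFn) (δ : ℝ) : Prop :=
  ∀ c : ℕ, ∀ᶠ m : ℕ in atTop, ∀ C : Circuit ((⊤ : SimpleGraph (Fin m)).edgeSet),
    C.IsOver (B (m ^ c)) → C.size ≤ m ^ c → ¬ C.Computes (cliqueFn m (kOf δ m))

/-- The crux with named pieces. -/
def Blind : Prop := ∃ δ : ℝ, 0 < δ ∧ δ < 1 / 2 ∧ BlindFor basis δ

/-- **Read-back.** The crux IS `Blind`, by `Iff.rfl` (inline gate classes = `IsPermGate`/`IsGRankGate`,
inline clique function = `cliqueFn`). -/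
theorem linAlgGateBlind_iff :
    Summit.PneNP.PneNP.Theses.ConvexRankGates.LinAlgGateBlind ↔ Blind := Iff.rfl

/-! ## The four statements of the line (named; the registered `stub_*` restate them verbatim, inlined
and fully qualified, so that a Theorems-side `propose --supports stmt-PneNP-10681` proof can copy the
text; `Registered.stub_*` are the name-keyed aliases taken as hypotheses of `LinAlgGateBlind_of`) -/

/-- **Statement A — the LINEARISATION CONJECTURE** (guarded section-module form, TRIAGE-r1-3 sharpening).
For pools `H₁,…,Hₙ ≤ Sym(d)` (one SUBGROUP per Boolean input — a PERM gate's input owns the subgroup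
generated by the permutations at the positions wired to it) and a target `τ`, there are `J ≤ N^a` TESTS
(`N = n + d + 2`), test `j` given by a subgroup `L_j ≤ Sym(d)` (a section normaliser), a modulus
`2 ≤ q_j ≤ N^a`, a representation `ρ_j` of `L_j` on the free module `(ℤ/q_j)^{D_j}`, `D_j ≤ N^a`, and a
probe `π_j ∈ L_j`,
such that for EVERY input `v`, with `H_v = ⨆_{vᵢ = 1} Hᵢ`:
`τ ∈ H_v ↔ ∀ j, (H_v ≤ L_j → Fix_{ρ_j}(H_v) ⊆ Fix_{ρ_j}(π_j))`.
Each guarded test is monotone in `v` and (stub B) one SPAN gate; `→` of the `↔` is soundness (forces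
`π_j` into every `H_v ∋ τ` with `H_v ≤ L_j`), `←` is completeness of the family. The exponent `a` is
UNIFORM in `d`: the regular module (`J = 1`, `L = Sym(d)`, `D = d!`) is exact but exponential. -/
def LinConj : Prop :=
  ∃ a : ℕ, ∀ (d n : ℕ) (H : Fin n → Subgroup (Equiv.Perm (Fin d))) (τ : Equiv.Perm (Fin d)),
    ∃ (J : ℕ) (L : Fin J → Subgroup (Equiv.Perm (Fin d))) (q D : Fin J → ℕ)
      (ρ : (j : Fin J) → Representation (ZMod (q j)) (L j) (Fin (D j) → ZMod (q j)))
      (π : (j : Fin J) → L j),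
      J ≤ (n + d + 2) ^ a ∧ (∀ j, 2 ≤ q j ∧ q j ≤ (n + d + 2) ^ a ∧ D j ≤ (n + d + 2) ^ a) ∧
      ∀ v : Fin n → Bool,
        (τ ∈ ⨆ (i : Fin n) (_ : v i = true), H i) ↔
          ∀ (j : Fin J) (hle : (⨆ (i : Fin n) (_ : v i = true), H i) ≤ L j)
            (w : Fin (D j) → ZMod (q j)),
            (∀ (h : Equiv.Perm (Fin d)) (hh : h ∈ ⨆ (i : Fin n) (_ : v i = true), H i),
                ρ j ⟨h, hle hh⟩ w = w) →
              ρ j (π j) w = w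

/-- **Statement B — GUARDED SECTION TESTS ARE SPAN GATES** (`SpanTests`, standalone, explicit bounds):
for ANY family of `J` guarded tests (as in statement A, no polynomiality assumed) deciding
`v ↦ [τ ∈ ⨆_{vᵢ=1} Hᵢ]`, with moduli `2 ≤ q_j ≤ S` and dimensions `D_j² ≤ S` (`S ≥ 2`), that function (any
Boolean `f` with that truth table — no decidability instance is fixed) has a `{∧₂, ∨₂} ∪ SPAN_S`-program
with at most `2J + 1` gates: one SPAN gate of dimension `D_j²` over `ℤ/q_j` per test, `J - 1` binary ANDs
(or the constant `true` when `J = 0`). -/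
def SpanTests : Prop :=
  ∀ (d n J S : ℕ) (H : Fin n → Subgroup (Equiv.Perm (Fin d))) (τ : Equiv.Perm (Fin d))
    (L : Fin J → Subgroup (Equiv.Perm (Fin d))) (q D : Fin J → ℕ)
    (ρ : (j : Fin J) → Representation (ZMod (q j)) (L j) (Fin (D j) → ZMod (q j)))
    (π : (j : Fin J) → L j),
    2 ≤ S → (∀ j, 2 ≤ q j ∧ q j ≤ S ∧ D j * D j ≤ S) →
    (∀ v : Fin n → Bool,
      (τ ∈ ⨆ (i : Fin n) (_ : v i = true), H i) ↔
        ∀ (j : Fin J) (hle : (⨆ (i : Fin n) (_ : v i = true), H i) ≤ L j)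
          (w : Fin (D j) → ZMod (q j)),
          (∀ (h : Equiv.Perm (Fin d)) (hh : h ∈ ⨆ (i : Fin n) (_ : v i = true), H i),
              ρ j ⟨h, hle hh⟩ w = w) →
            ρ j (π j) w = w) →
    ∃ f : (Fin n → Bool) → Bool, (∀ v : Fin n → Bool, f v = true ↔ τ ∈ ⨆ (i : Fin n) (_ : v i = true), H i) ∧
      CktSize (spanBasis S) (fun (v : Fin n → Bool) (_ : Unit) => f v) (2 * J + 1)

/-- DERIVED (proved below from A and B: `permSpanSim_of`) — **PERM gates are polynomial SPAN circuits**
(`PermSpanSim`): the subgroup-labelled membership function of `n` pools on `d` points has a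
`{∧₂, ∨₂} ∪ SPAN_{N^a}`-program with at most `N^a` gates, `N = n + d + 2`. -/
def PermSpanSim : Prop :=
  ∃ a : ℕ, ∀ (d n : ℕ) (H : Fin n → Subgroup (Equiv.Perm (Fin d))) (τ : Equiv.Perm (Fin d)),
    ∃ f : (Fin n → Bool) → Bool, (∀ v : Fin n → Bool, f v = true ↔ τ ∈ ⨆ (i : Fin n) (_ : v i = true), H i) ∧
      CktSize (spanBasis ((n + d + 2) ^ a)) (fun (v : Fin n → Bool) (_ : Unit) => f v) ((n + d + 2) ^ a)

/-- **Statement C — REBASING A CIRCUIT ONTO THE LINEAR BASIS** (`PermElimination`, standalone, explicit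
bounds): if every subgroup-labelled membership function with `d ≤ s` points and `n ≤ |ι| + size` pools
has a `{∧₂, ∨₂} ∪ SPAN_S`-program with `≤ M` gates (`M ≥ 1`, `s ≤ S`), then every `basis s`-circuit `C`
on the finite input type `ι` can be rewritten as a `linBasis S`-circuit with at most `1 + M · size` gates
computing the same function (each PERM gate occurrence reads `≤ |ι| + size` distinct wires). -/
def PermElimination : Prop :=
  ∀ (ι : Type) [Fintype ι] (s S M : ℕ) (C : Circuit ι), C.IsOver (basis s) → s ≤ S → 1 ≤ M →
    (∀ (d n : ℕ), d ≤ s → n ≤ Fintype.card ι + C.size →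
      ∀ (H : Fin n → Subgroup (Equiv.Perm (Fin d))) (τ : Equiv.Perm (Fin d)),
        ∃ f : (Fin n → Bool) → Bool, (∀ v : Fin n → Bool, f v = true ↔ τ ∈ ⨆ (i : Fin n) (_ : v i = true), H i) ∧
          CktSize (spanBasis S) (fun (v : Fin n → Bool) (_ : Unit) => f v) M) →
    ∃ C' : Circuit ι, C'.IsOver (linBasis S) ∧ C'.size ≤ 1 + M * C.size ∧ ∀ x, C'.eval x = C.eval x

/-- DERIVED (proved below from `PermSpanSim` and C: `permElim_of`) — **PERM elimination at the circuit
level** (`PermElim`): every circuit over the crux's basis `basis s` on a finite input type `ι` can be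
rewritten as a circuit over `linBasis (N^a)` with at most `N^a` gates computing the same function,
`N = size + |ι| + s + 2`. -/
def PermElim : Prop :=
  ∃ a : ℕ, ∀ (ι : Type) [Fintype ι] (s : ℕ) (C : Circuit ι), C.IsOver (basis s) →
    ∃ C' : Circuit ι, C'.IsOver (linBasis ((C.size + Fintype.card ι + s + 2) ^ a)) ∧
      C'.size ≤ (C.size + Fintype.card ι + s + 2) ^ a ∧ ∀ x, C'.eval x = C.eval x

/-- **Statement D — BLINDNESS OF THE LINEAR BASIS** (`LinBlind`): the crux with PERM replaced by SPAN,
i.e. for `{∧₂, ∨₂} ∪ SPAN_{m^c} ∪ GRANK_{m^c}`-circuits. Implied by the crux (`SPAN_s ⊆ PERM_{s²}`);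
with A–C equivalent to it. -/
def LinBlind : Prop := ∃ δ : ℝ, 0 < δ ∧ δ < 1 / 2 ∧ BlindFor linBasis δ

/-! ## The registered stubs (`sorry` lives only here) -/

/-- **STUB A · `stub_linearisation`** (XL, OPEN — THE LEVER; the line's own conjecture) — the
Linearisation Conjecture `LinConj` (docstring above), verbatim. WHY PLAUSIBLY TRUE: it is the monotone,
non-uniform shadow of Babai–Luks–Seress (permutation-group membership in NC along a structure forest
whose nonabelian levels are bounded-base and whose abelian levels are linear algebra), with the two
failure modes of low-arity permutation modules identified and repaired by SECTION modules exactly as the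
guard allows (parity in abelian 2-sections: affine `𝔽₂`-module of dimension `t+1`; local sign on giant
sections `Alt(A)×Alt(B)`: the 2-dimensional `sgn_A`-module of `L = (S_A × S_B) ∩ A_d`, TRIAGE-r1-3's
Littlewood–Richardson computation showing every `S_d`-module test needs dimension `C(d-1,d/2-1)` there);
subgroup chains in `Sym(d)` have length `< 3d/2` (Cameron–Solomon–Turull) and every subgroup is
`⌊d/2⌋`-generated (McIver–Neumann), so polynomially many sections is the natural bet; toys (card, `d ≤ 7`,
kit j005287) and the triage probes (twisted diagonals, `PGL(2,5) < S_6` at arity 4) found no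
counterexample to the section form. WHY IT MIGHT FAIL: the structure forest of `H_v` depends on `v`; a
pool family whose `2^n` generated subgroups run through superpolynomially many inequivalent sections
NOT dominated by polynomially many normalisers `L_j` would break the uniform exponent. The abelian
stress family of TRIAGE-r1-2 (ii), cyclic pools in `(ℤ/4)^t ↪ Sym(4t)` (Lichter motive: `ℤ/4`-span is not
a field span), is DEFUSED by the ring typing (one affine `ℤ/4`-test, FIRST MILESTONE below); the live
stress families are nonabelian: Sylow 2-subgroups of `S_{2^h}` (deep lattice, many abelian sections
glued nonabelianly), wreath `S_a ≀ S_b` / `A_a ≀ S_b` pools whose block system varies with `v`, diagonal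
pools, at `d = 12–16` (GAP, exhaustive closure feasible). Uses `d ≤ s` of the crux (honours
`not_withoutPermDim`: the bound is polynomial in `d`, not in the arity). Leans on (Mathlib):
`Subgroup`, `iSup`, `Equiv.Perm`, `Representation`, `ZMod`; nothing of BLS87 / CFSG is in the tree.
FIRST MILESTONE (provable now, the abelian instance = abelian PERM gates): if the pools AND the target lie
in an ABELIAN `Γ ≤ Sym(d)`, one affine test per prime `p ∣ |Γ|` decides every `v` (`L = Γ`, `q = p^k =`
exponent of `Γ_p`, `q ≤ d`; `Γ_p ↪ (ℤ/q)^t`, `t ≤ d`; `W = (ℤ/q)^{t+1}`, `u·(x,c) = (x, c + ⟨u_p,x⟩)`, so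
`Fix(K) = K_p^⊥ ⊕ ℤ/q`, and `K_p^⊥ ⊆ τ_p^⊥ ↔ τ_p ∈ K_p^⊥⊥ = K_p` by the perfect pairing on `(ℤ/q)^t`); a
target outside `Γ` but centralising it: the same with `⟨Γ, τ⟩`; a target not centralising `H_v` is caught
by the arity-2 permutation module `(ℤ/2)[Ω²]` (2-closures of abelian groups lie in the abelian orbitwise
product), which leaves, as the first genuinely open sub-case, targets centralising some `H_v` but not `Γ`.
[Babai–Luks–Seress STOC 1987; Cameron–Solomon–Turull, J. Algebra 127 (1989); McIver–Neumann,
Quart. J. Math. 38 (1987); Wielandt 1969 (invariant relations); PitassiRobere2018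
doi:10.1145/3188745.3188914 (why every characteristic must be allowed); Lichter LICS 2023 /
DawarGradelLichter2022 (why `ℤ/2^k` and not only fields)] -/
theorem stub_linearisation : ∃ a : ℕ, ∀ (d n : ℕ) (H : Fin n → Subgroup (Equiv.Perm (Fin d))) (τ : Equiv.Perm (Fin d)), ∃ (J : ℕ) (L : Fin J → Subgroup (Equiv.Perm (Fin d))) (q D : Fin J → ℕ) (ρ : (j : Fin J) → Representation (ZMod (q j)) (L j) (Fin (D j) → ZMod (q j))) (π : (j : Fin J) → L j), J ≤ (n + d + 2) ^ a ∧ (∀ j, 2 ≤ q j ∧ q j ≤ (n + d + 2) ^ a ∧ D j ≤ (n + d + 2) ^ a) ∧ ∀ v : Fin n → Bool, (τ ∈ ⨆ (i : Fin n) (_ : v i = true), H i) ↔ ∀ (j : Fin J) (hle : (⨆ (i : Fin n) (_ : v i = true), H i) ≤ L j) (w : Fin (D j) → ZMod (q j)), (∀ (h : Equiv.Perm (Fin d)) (hh : h ∈ ⨆ (i : Fin n) (_ : v i = true), H i), ρ j ⟨h, hle hh⟩ w = w) → ρ j (π j) w = w := by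
  sorry

/-- **STUB B · `stub_spanTests`** (M/L, PROVABLE NOW — linear duality + circuit assembly; standalone,
no conjecture inside) — `SpanTests`: given ANY exact family of `J` guarded tests for `(d, n, H, τ)` with
`2 ≤ q_j ≤ S`, `D_j² ≤ S`, EACH GUARDED TEST IS ONE SPAN GATE over `ℤ/q_j` of dimension `D_j²`: with
`U_i := Σ_{h ∈ H_i} rowspace(ρ_j(h) - 1)`
(inputs with `H_i ≤ L_j`) one has `Fix(H_v) = (Σ_{vᵢ=1} U_i)^⊥` and `Fix(π_j) = rowspace(ρ_j(π_j) - 1)^⊥`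
(standard pairing on `(ℤ/q)^D`), so by the double annihilator `V^⊥⊥ = V` for submodules of `(ℤ/q)^D`
(`q` prime: finite-dimensional duality, `Subspace.dualAnnihilator_dualCoannihilator_eq`; general `q`:
`ℤ/q` is self-injective — count `|V^⊥| = q^D/|V|` with `AddChar`/Pontryagin duality of Mathlib, or CRT to
`ℤ/p^k` and induct on the `p`-adic filtration) the test reads `rowspace(ρ_j(π_j) - 1) ⊆ Σ_{vᵢ=1} U_i`, a
multi-target span program, folded into ONE target in `(ℤ/q)^{D×D}` (target = the matrix `ρ_j(π_j) - 1`;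
input `i` owns the matrices "row `t` := `u`", `u` in a spanning set of `U_i`, `t < D`); the GUARD is free:
an input with `H_i ⊄ L_j` owns the target itself (then `H_v ≤ L_j ↔` no such input is on, since `L_j` is a
subgroup). The `J` gates are wired to the `n` inputs (`CktSize.gate` + `rewire`; positions = a finite
enumeration of (input, owned vector)), and their AND costs `J - 1` further `∧₂` gates (`cktSize_all`
pattern of `CircuitLowerBoundsProofs`; `J = 0`: the constant `true` is the SPAN gate `q = 2, D = 0, t = 0`,
`isSpanGate_const_true`), all inside `spanBasis S` with `≤ 2J + 1` gates. Fixed points of a generated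
group = common fixed points of generators (`Subgroup.closure_induction`/`iSup` induction). The polynomial
uniformity is NOT this stub's business (`permSpanSim_of` below derives `PermSpanSim` from A + B). Why it
might need reshaping: only bookkeeping (enumerating owned vectors as `Fin`-positions). -/
theorem stub_spanTests : ∀ (d n J S : ℕ) (H : Fin n → Subgroup (Equiv.Perm (Fin d))) (τ : Equiv.Perm (Fin d)) (L : Fin J → Subgroup (Equiv.Perm (Fin d))) (q D : Fin J → ℕ) (ρ : (j : Fin J) → Representation (ZMod (q j)) (L j) (Fin (D j) → ZMod (q j))) (π : (j : Fin J) → L j), 2 ≤ S → (∀ j, 2 ≤ q j ∧ q j ≤ S ∧ D j * D j ≤ S) → (∀ v : Fin n → Bool, (τ ∈ ⨆ (i : Fin n) (_ : v i = true), H i) ↔ ∀ (j : Fin J) (hle : (⨆ (i : Fin n) (_ : v i = true), H i) ≤ L j) (w : Fin (D j) → ZMod (q j)), (∀ (h : Equiv.Perm (Fin d)) (hh : h ∈ ⨆ (i : Fin n) (_ : v i = true), H i), ρ j ⟨h, hle hh⟩ w = w) → ρ j (π j) w = w) → ∃ f : (Fin n → Bool) → Bool, (∀ v : Fin n → Bool,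 f v = true ↔ τ ∈ ⨆ (i : Fin n) (_ : v i = true), H i) ∧ Literature.Computability.Complexity.CktSize ({Literature.Computability.Complexity.GateFn.and 2, Literature.Computability.Complexity.GateFn.or 2} ∪ {g | ∃ q D : ℕ, 2 ≤ q ∧ q ≤ S ∧ D ≤ S ∧ ∃ (w : Fin g.1 → Fin D → ZMod q) (t : Fin D → ZMod q), ∀ v : Fin g.1 → Bool, g.2 v = true ↔ t ∈ Submodule.span (ZMod q) (w '' {i | v i = true})}) (fun (v : Fin n → Bool) (_ : Unit) => f v) (2 * J + 1) := by
  sorry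

/-- **STUB C · `stub_permElimination`** (M, PROVABLE NOW — circuit surgery; standalone) —
`PermElimination`: rebase a `basis s`-circuit `C` on a finite input type `ι` gate by gate with the tree's
`Summit.PneNP.PneNP.Theorems.Capture.Negative.Circuit.rebase'` (wire form: each gate as a function of
the WIRE valuation `y : ι ⊕ ℕ → Bool`; target basis must contain the constant `0`, which is a GRANK gate
of dimension `0`, `isGRankGate_const_false` below). `∧₂`, `∨₂`, GRANK gates simulate themselves
(`CktSize.gate … g.args`, one gate). A PERM gate occurrence `(d ≤ s, σ, τ, args)` reads at most
`n := |ι| + C.size` distinct wires (inputs, and gates `< C.size` by `C.wf`); with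
`H_w := Subgroup.closure (σ '' (args ⁻¹' {w}))` one has
`[τ ∈ closure (σ '' {a | y (args a)})] = [τ ∈ ⨆_{y w = 1} H_w]` (`Subgroup.closure_iUnion`), so after
enumerating the wires (`Fintype.equivFin`, `CktSize.rewire`) the hypothesis gives a `spanBasis S`-program
with `≤ M` gates for it (`spanBasis S ⊆ linBasis S`), so `Circuit.rebase'` yields `≤ 1 + M · C.size` gates
over `linBasis S`. The polynomial uniformity is NOT this stub's business (`permElim_of` below derives
`PermElim` from `PermSpanSim` + C). Uses the size bound and `d ≤ s` (honours `not_withoutSizeBound`,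
`not_withoutPermDim`). Leans on: `Circuit.rebase'` (or its 40-line proof pattern `cktSize_allWires'`),
`CktSize.{gate,rewire,of_le,basis_mono}`, `IsGRankGate.mono`, `Subgroup.closure_iUnion`. -/
theorem stub_permElimination : ∀ (ι : Type) [Fintype ι] (s S M : ℕ) (C : Literature.Computability.Complexity.Circuit ι), C.IsOver ({Literature.Computability.Complexity.GateFn.and 2, Literature.Computability.Complexity.GateFn.or 2} ∪ {g | Literature.Computability.Complexity.IsPermGate s g ∨ Literature.Computability.Complexity.IsGRankGate s g}) → s ≤ S → 1 ≤ M → (∀ (d n : ℕ), d ≤ s → n ≤ Fintype.card ι + C.size → ∀ (H : Fin n → Subgroup (Equiv.Perm (Fin d))) (τ : Equiv.Perm (Fin d)), ∃ f : (Fin n → Bool) → Bool, (∀ v : Fin n → Bool, f v = true ↔ τ ∈ ⨆ (i : Fin n) (_ : v i = true), H i) ∧ Literature.Computability.Complexity.CktSize ({Literature.Computability.Complexity.GateFn.and 2, Literature.Computability.Complexity.GateFn.or 2} ∪ {g | ∃ q D : ℕ, 2 ≤ q ∧ q ≤ S ∧ D ≤ S ∧ ∃ (w : Fin g.1 → Fin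 D → ZMod q) (t : Fin D → ZMod q), ∀ v : Fin g.1 → Bool, g.2 v = true ↔ t ∈ Submodule.span (ZMod q) (w '' {i | v i = true})}) (fun (v : Fin n → Bool) (_ : Unit) => f v) M) → ∃ C' : Literature.Computability.Complexity.Circuit ι, C'.IsOver ({Literature.Computability.Complexity.GateFn.and 2, Literature.Computability.Complexity.GateFn.or 2} ∪ {g | (∃ q D : ℕ, 2 ≤ q ∧ q ≤ S ∧ D ≤ S ∧ ∃ (w : Fin g.1 → Fin D → ZMod q) (t : Fin D → ZMod q), ∀ v : Fin g.1 → Bool, g.2 v = true ↔ t ∈ Submodule.span (ZMod q) (w '' {i | v i = true})) ∨ Literature.Computability.Complexity.IsGRankGate S g}) ∧ C'.size ≤ 1 + M * C.size ∧ ∀ x, C'.eval x = C.eval x := by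
  sorry

/-- **STUB D · `stub_linearBasisBlind`** (XL⁺, OPEN — THE RESIDUAL; hardest in absolute terms; shared
target of the sibling lines) — `LinBlind`: for some `δ ∈ (0, 1/2)` and every `c`, eventually in `m`, no
circuit with `≤ m^c` gates over `{∧₂, ∨₂} ∪ SPAN_{m^c} ∪ GRANK_{m^c}` computes `CLIQUE(m, ⌈m^δ⌉₊)`. This
is the crux with its nonabelian door replaced by monotone span programs over the rings `ℤ/q`,
`q ≤ m^c`, dimension `≤ m^c` — up to `c ↦ O(c)` exactly the crux for ABELIAN PERM gates (all moduli at
once, one per gate; the line never merges characteristics, cf. barrier `CompositeModulusDegree`). WHY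
PLAUSIBLY TRUE: implied by the crux (`SPAN_s ⊆ PERM_{s²}`, proved: `linBlind_of_linAlgGateBlind`);
single SPAN gate = monotone span program, exponential lower bounds known (PitassiRobere2018 via the
monotone projection SAT → CLIQUE; Gál 2001 rank measure); the referee pair of the route (bare
`m^δ`-cliques vs dense `G(m, 1 - C ln m / k)`) is where cards `dnf-invariant-wide-gates-see-small-cliques`
(one-sided `SG` ⇒ this statement, basis-agnostic since `SPAN∘OR ⊆ SPAN` by giving every fresh input the
same vector) and `perm-door-lifted-closure-programs` (planted CSP, labelled rank measure; abelian, one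
field; span programs over `ℤ/p^k`, `k ≥ 2`, are their open case (O2)) attack it. WHY IT MIGHT FAIL /
COST: the GRANK half is untouched, so this statement still implies
`dc(CL_{m,⌈m^δ⌉₊}) > m^c` over every field (Disproof headline; `not_linBlindWithoutGRankDim` below is the
one-gate kill when `d ≤ m^c` is dropped) — any proof is ≥ VNP ⊄ VBP unless GRANK is re-typed (tame /
read-≤2), which is planner business outside this line; and in-circuit span-program lower bounds with
MIXED characteristics (`𝔽₂ ∧ 𝔽₃`) are uncharted (perm-door (O1x)). Honours `not_withoutSizeBound`,
`not_withoutGRankDim`, `not_blindConstK`, `not_uniformThreshold`, `blind_window` (same quantifier shape,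
`k → ∞`, both bounds kept). [PitassiRobere2018 doi:10.1145/3188745.3188914; Gál, Comput. Complexity 10
(2001); GoosKamathRobereSokolov2019; Razborov1985; AlonBoppana1987] -/
theorem stub_linearBasisBlind : ∃ δ : ℝ, 0 < δ ∧ δ < 1 / 2 ∧ ∀ c : ℕ, ∀ᶠ m : ℕ in Filter.atTop, ∀ C : Literature.Computability.Complexity.Circuit ((⊤ : SimpleGraph (Fin m)).edgeSet), C.IsOver ({Literature.Computability.Complexity.GateFn.and 2, Literature.Computability.Complexity.GateFn.or 2} ∪ {g | (∃ q D : ℕ, 2 ≤ q ∧ q ≤ m ^ c ∧ D ≤ m ^ c ∧ ∃ (w : Fin g.1 → Fin D → ZMod q) (t : Fin D → ZMod q), ∀ v : Fin g.1 → Bool, g.2 v = true ↔ t ∈ Submodule.span (ZMod q) (w '' {i | v i = true})) ∨ Literature.Computability.Complexity.IsGRankGate (m ^ c) g}) → C.size ≤ m ^ c → ¬ C.Computes (Literature.Computability.Complexity.cliqueFn m ⌈(m : ℝ) ^ δ⌉₊) := by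
  sorry

/-! ## Consistency: each named statement IS its registered stub (definitionally) -/

theorem linConj_holds : LinConj := stub_linearisation
theorem spanTests_holds : SpanTests := stub_spanTests
theorem permElimination_holds : PermElimination := stub_permElimination
theorem linBlind_holds : LinBlind := stub_linearBasisBlind

/-! ## Name-keyed aliases of the four statements (the hypotheses of the composition) -/
namespace Registered

/-- Alias of `LinConj` keyed by the registered stub name. -/
abbrev stub_linearisation : Prop := LinConj
/-- Alias of `SpanTests` keyed by the registered stub name. -/
abbrev stub_spanTests : Prop := SpanTests
/-- Alias of `PermElimination` keyed by the registered stub name. -/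
abbrev stub_permElimination : Prop := PermElimination
/-- Alias of `LinBlind` keyed by the registered stub name. -/
abbrev stub_linearBasisBlind : Prop := LinBlind

end Registered

/-! ## Proved glue: monotonicity of the bases in the size parameter, constants -/

theorem IsSpanGate.mono {s t : ℕ} {g : GateFn} (h : IsSpanGate s g) (hst : s ≤ t) : IsSpanGate t g := by
  obtain ⟨q, D, hq, hqs, hDs, hrest⟩ := h
  exact ⟨q, D, hq, hqs.trans hst, hDs.trans hst, hrest⟩

theorem linBasis_mono {s t : ℕ} (hst : s ≤ t) : linBasis s ⊆ linBasis t := by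
  rintro g (hg | hg | hg)
  · exact Or.inl hg
  · exact Or.inr (Or.inl (hg.mono hst))
  · exact Or.inr (Or.inr (hg.mono hst))

theorem basis_mono {s t : ℕ} (hst : s ≤ t) : basis s ⊆ basis t := by
  rintro g (hg | hg | hg)
  · exact Or.inl hg
  · exact Or.inr (Or.inl (hg.mono hst))
  · exact Or.inr (Or.inr (hg.mono hst))

theorem spanBasis_subset_linBasis (s : ℕ) : spanBasis s ⊆ linBasis s := by
  rintro g (hg | hg)
  · exact Or.inl hg
  · exact Or.inr (Or.inl hg)

theorem spanBasis_mono {s t : ℕ} (hst : s ≤ t) : spanBasis s ⊆ spanBasis t := by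
  rintro g (hg | hg)
  · exact Or.inl hg
  · exact Or.inr (IsSpanGate.mono hg hst)

/-- **SPAN gates are monotone** (enlarging the set of selected vectors enlarges the span): the rewritten
model stays monotone BY SYNTAX. -/
theorem IsSpanGate.monotone {s : ℕ} {g : GateFn} (h : IsSpanGate s g) : Monotone g.2 := by
  obtain ⟨q, D, -, -, -, w, t, hg⟩ := h
  exact monotone_of_forall_iff hg fun v v' hvv' hv =>
    Submodule.span_mono (Set.image_mono fun i hi => eq_true_of_le_of_eq_true (hvv' i) hi) hv

/-- The constant `true` (any arity) is a SPAN gate at every `s ≥ 2` (`q = 2`, `D = 0`, `t = 0`). -/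
theorem isSpanGate_const_true {s : ℕ} (hs : 2 ≤ s) (n : ℕ) : IsSpanGate s ⟨n, fun _ => true⟩ :=
  ⟨2, 0, le_rfl, hs, Nat.zero_le _, fun _ => 0, 0, fun _ => ⟨fun _ => Submodule.zero_mem _, fun _ => rfl⟩⟩

/-- The constant `false` (any arity) is a GRANK gate of dimension `0` (`θ = 1`, `F = ℚ`), hence in
`linBasis s` for EVERY `s` (what `Circuit.rebase'` needs of the target basis in stub C). -/
theorem isGRankGate_const_false (s n : ℕ) : IsGRankGate s ⟨n, fun _ => false⟩ := by
  refine ⟨ℚ, inferInstance, 0, 1, Nat.zero_le _, 0, fun _ => 0, fun v => ?_⟩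
  simp only [Bool.false_eq_true, false_iff, not_le]
  have := (symbolicMatrix (0 : Matrix (Fin 0) (Fin 0) ℚ) (fun _ : Fin n => 0) v).rank_le_card_width
  simp only [Fintype.card_fin] at this
  omega

theorem const_false_mem_linBasis (s n : ℕ) : (⟨n, fun _ => false⟩ : GateFn) ∈ linBasis s :=
  Or.inr (Or.inr (isGRankGate_const_false s n))

/-! ## The composition: the four stubs imply the crux, by name -/

/-- Size bookkeeping: `(m^c + m^2 + m^c + 2)`-type sums are `≤ m^{c+3}` for `m ≥ 4`. -/
theorem size_budget {m c t e : ℕ} (hm : 4 ≤ m) (ht : t ≤ m ^ c) (he : e ≤ m ^ 2) :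
    t + e + m ^ c + 2 ≤ m ^ (c + 3) := by
  have h1 : 1 ≤ m := le_trans (by norm_num) hm
  have hc2 : m ^ c ≤ m ^ (c + 2) := Nat.pow_le_pow_right h1 (by omega)
  have h22 : m ^ 2 ≤ m ^ (c + 2) := Nat.pow_le_pow_right h1 (by omega)
  have htwo : 2 ≤ m ^ (c + 2) :=
    le_trans (by omega : 2 ≤ m) (by simpa using Nat.pow_le_pow_right h1 (show 1 ≤ c + 2 by omega))
  calc t + e + m ^ c + 2 ≤ m ^ (c + 2) + m ^ (c + 2) + m ^ (c + 2) + m ^ (c + 2) := by omega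
    _ = 4 * m ^ (c + 2) := by ring
    _ ≤ m * m ^ (c + 2) := Nat.mul_le_mul_right _ hm
    _ = m ^ (c + 3) := by ring

/-- Powers of a base `≥ 2` dominate: `N^i ≤ N^j` for `i ≤ j`, and `N ≤ N^j` for `1 ≤ j`. -/
theorem pow_le_pow_of_le {N i j : ℕ} (hN : 2 ≤ N) (hij : i ≤ j) : N ^ i ≤ N ^ j :=
  Nat.pow_le_pow_right (by omega) hij

theorem le_pow_self_of {N j : ℕ} (hN : 2 ≤ N) (hj : 1 ≤ j) : N ≤ N ^ j := by
  calc N = N ^ 1 := (pow_one N).symm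
    _ ≤ N ^ j := Nat.pow_le_pow_right (by omega) hj

/-- **A + B ⇒ `PermSpanSim`** (the polynomial uniformity of the gate-level simulation): with the tests of
the Linearisation Conjecture at exponent `a₀` and `N = n + d + 2 ≥ 2`, stub B at `S = N^{2a₀+2}` gives a
program with `2J + 1 ≤ 3N^{a₀} ≤ N^{a₀+2}` gates; exponent `a = 2a₀ + 2` serves both bounds. -/
theorem permSpanSim_of (hA : LinConj) (hB : SpanTests) : PermSpanSim := by
  obtain ⟨a₀, hA⟩ := hA
  refine ⟨2 * a₀ + 2, fun d n H τ => ?_⟩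
  obtain ⟨J, L, q, D, ρ, π, hJ, hb, hiff⟩ := hA d n H τ
  have hN : 2 ≤ n + d + 2 := by omega
  set N := n + d + 2 with hNdef
  have ha₀ : N ^ a₀ ≤ N ^ (2 * a₀ + 2) := pow_le_pow_of_le hN (by omega)
  have hS2 : 2 ≤ N ^ (2 * a₀ + 2) := hN.trans (le_pow_self_of hN (by omega))
  obtain ⟨f, hf, hsize⟩ := hB d n J (N ^ (2 * a₀ + 2)) H τ L q D ρ π hS2
    (fun j => ⟨(hb j).1, (hb j).2.1.trans ha₀, by
      calc D j * D j ≤ N ^ a₀ * N ^ a₀ := Nat.mul_le_mul (hb j).2.2 (hb j).2.2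
        _ = N ^ (2 * a₀) := by rw [← pow_add, two_mul]
        _ ≤ N ^ (2 * a₀ + 2) := pow_le_pow_of_le hN (by omega)⟩) hiff
  refine ⟨f, hf, hsize.of_le ?_⟩
  -- 2J + 1 ≤ 3 N^{a₀} ≤ N^2 · N^{a₀} = N^{a₀ + 2} ≤ N^{2a₀ + 2}
  have h1 : 1 ≤ N ^ a₀ := Nat.one_le_pow _ _ (by omega)
  have h4 : 4 ≤ N ^ 2 := by
    calc 4 = 2 ^ 2 := by norm_num
      _ ≤ N ^ 2 := Nat.pow_le_pow_left hN 2
  calc 2 * J + 1 ≤ 3 * N ^ a₀ := by omega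
    _ ≤ N ^ 2 * N ^ a₀ := Nat.mul_le_mul_right _ (by omega)
    _ = N ^ (a₀ + 2) := by rw [← pow_add, add_comm]
    _ ≤ N ^ (2 * a₀ + 2) := pow_le_pow_of_le hN (by omega)

/-- **`PermSpanSim` + C ⇒ `PermElim`** (the polynomial uniformity of the circuit-level rebasing): with
`N = size + |ι| + s + 2 ≥ 2` and gate-level exponent `a`, stub C at `S = M = N^{a+1}` gives
`≤ 1 + N^{a+1} · size ≤ N^{a+3}` gates; exponent `a + 3` serves both bounds. -/
theorem permElim_of (hP : PermSpanSim) (hC : PermElimination) : PermElim := by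
  obtain ⟨a, hP⟩ := hP
  refine ⟨a + 3, fun ι _ s C hCB => ?_⟩
  have hN : 2 ≤ C.size + Fintype.card ι + s + 2 := by omega
  set N := C.size + Fintype.card ι + s + 2 with hNdef
  have hsS : s ≤ N ^ (a + 1) := (by omega : s ≤ N).trans (le_pow_self_of hN (by omega))
  have hM1 : 1 ≤ N ^ (a + 1) := Nat.one_le_pow _ _ (by omega)
  have hsim : ∀ (d n : ℕ), d ≤ s → n ≤ Fintype.card ι + C.size →
      ∀ (H : Fin n → Subgroup (Equiv.Perm (Fin d))) (τ : Equiv.Perm (Fin d)),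
        ∃ f : (Fin n → Bool) → Bool, (∀ v : Fin n → Bool, f v = true ↔ τ ∈ ⨆ (i : Fin n) (_ : v i = true), H i) ∧
          CktSize (spanBasis (N ^ (a + 1))) (fun (v : Fin n → Bool) (_ : Unit) => f v) (N ^ (a + 1)) := by
    intro d n hd hn H τ
    obtain ⟨f, hf, hsize⟩ := hP d n H τ
    have hnd : n + d + 2 ≤ N := by omega
    have hpow : (n + d + 2) ^ a ≤ N ^ (a + 1) :=
      (Nat.pow_le_pow_left hnd a).trans (pow_le_pow_of_le hN (by omega))
    exact ⟨f, hf, (hsize.basis_mono (spanBasis_mono hpow)).of_le hpow⟩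
  obtain ⟨C', hC'B, hC'size, hC'eval⟩ := hC ι s (N ^ (a + 1)) (N ^ (a + 1)) C hCB hsS hM1 hsim
  refine ⟨C', hC'B.mono (linBasis_mono (pow_le_pow_of_le hN (by omega))), hC'size.trans ?_, hC'eval⟩
  -- 1 + N^{a+1} · size ≤ 1 + N^{a+1} · N ≤ 2 N^{a+2} ≤ N^{a+3}
  have hsz : C.size ≤ N := by omega
  have h1 : 1 ≤ N ^ (a + 2) := Nat.one_le_pow _ _ (by omega)
  calc 1 + N ^ (a + 1) * C.size ≤ 1 + N ^ (a + 1) * N := by gcongr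
    _ = 1 + N ^ (a + 2) := by rw [← pow_succ]
    _ ≤ 2 * N ^ (a + 2) := by omega
    _ ≤ N * N ^ (a + 2) := Nat.mul_le_mul_right _ hN
    _ = N ^ (a + 3) := by rw [← pow_succ']

/-- **`LinAlgGateBlind` from the four stubs** (no `sorry`; the asymptotic bookkeeping is done here and in
`permSpanSim_of` / `permElim_of`): stubs A–C rewrite every `basis (m^c)`-circuit of size `≤ m^c` as a
`linBasis (m^{(c+3)a})`-circuit of size `≤ m^{(c+3)a}` computing the same function (`PermElim` at
`N = size + #E(K_m) + m^c + 2 ≤ m^{c+3}`, `m ≥ 4`), which stub D forbids from computing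
`CLIQUE(m, ⌈m^δ⌉₊)` at the exponent `(c+3)a`. -/
theorem LinAlgGateBlind_of (hA : Registered.stub_linearisation) (hB : Registered.stub_spanTests)
    (hC : Registered.stub_permElimination) (hD : Registered.stub_linearBasisBlind) :
    Summit.PneNP.PneNP.Theses.ConvexRankGates.LinAlgGateBlind := by
  rw [linAlgGateBlind_iff]
  obtain ⟨a, hElim⟩ := permElim_of (permSpanSim_of hA hB) hC
  obtain ⟨δ, hδ0, hδ1, hlb⟩ := hD
  refine ⟨δ, hδ0, hδ1, fun c => ?_⟩
  filter_upwards [hlb ((c + 3) * a), eventually_ge_atTop 4] with m hm h4 C hCB hsize hcomp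
  obtain ⟨C', hC'B, hC'size, hC'eval⟩ := hElim _ (m ^ c) C hCB
  have hcard : Fintype.card ((⊤ : SimpleGraph (Fin m)).edgeSet) ≤ m ^ 2 := by
    calc Fintype.card ((⊤ : SimpleGraph (Fin m)).edgeSet)
        ≤ Fintype.card (Sym2 (Fin m)) := Fintype.card_le_of_injective Subtype.val Subtype.val_injective
      _ ≤ Fintype.card (Fin m × Fin m) :=
          Fintype.card_le_of_surjective (Sym2.mk (α := Fin m)).uncurry Sym2.mk_surjective
      _ = m ^ 2 := by simp [sq]
  have hN : C.size + Fintype.card ((⊤ : SimpleGraph (Fin m)).edgeSet) + m ^ c + 2 ≤ m ^ (c + 3) :=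
    size_budget h4 hsize hcard
  have hbound : (C.size + Fintype.card ((⊤ : SimpleGraph (Fin m)).edgeSet) + m ^ c + 2) ^ a ≤
      m ^ ((c + 3) * a) := by
    rw [pow_mul]
    exact Nat.pow_le_pow_left hN a
  exact hm C' (hC'B.mono (linBasis_mono hbound)) (hC'size.trans hbound)
    fun x => (hC'eval x).trans (hcomp x)

/-- Wiring check: the registered stubs feed `LinAlgGateBlind_of` as stated. -/
example : Summit.PneNP.PneNP.Theses.ConvexRankGates.LinAlgGateBlind :=
  LinAlgGateBlind_of stub_linearisation stub_spanTests stub_permElimination stub_linearBasisBlind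


/-! ## Sanity I (Disproof honoured): the GRANK dimension bound of stub D is load-bearing

Re-proved for the LINEAR basis from the landed Negative lemmas (`Negative.DetGate`,
`Negative.CliquePolyDetRepr`): drop `d ≤ m^c` from the GRANK gates of `linBasis` and ONE gate (the
size-tracked Valiant matrix of the clique polynomial over `ℚ`) computes `CLIQUE(m, ⌈m^δ⌉₊)` — stub D with
an unbounded GRANK door is FALSE, exactly as `Disproof.not_withoutGRankDim` for the crux. -/

/-- `k = ⌈m^δ⌉₊ ≥ 2` for `δ > 0`, `m ≥ 2`. -/
theorem two_le_kOf {δ : ℝ} (hδ : 0 < δ) {m : ℕ} (hm : 2 ≤ m) : 2 ≤ kOf δ m := by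
  have h1 : (1 : ℝ) < (m : ℝ) ^ δ := Real.one_lt_rpow (by exact_mod_cast hm) hδ
  have : 1 < kOf δ m := Nat.lt_ceil.2 (by exact_mod_cast h1)
  omega

/-- **`CLIQUE(m,k)` is ONE GRANK gate (over `ℚ`) of dimension `1 + C(m,k) · #E(K_m)`** (`k ≥ 2`), from the
landed Negative lemmas. -/
theorem exists_oneGRankGate_computes_cliqueFn (m k : ℕ) (hk : 2 ≤ k) :
    ∃ C : Circuit ((⊤ : SimpleGraph (Fin m)).edgeSet),
      C.IsOver {g | IsGRankGate (1 + m.choose k * CliqueLPGate.nE m) g} ∧ C.size ≤ 1 ∧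
        C.Computes (cliqueFn m k) := by
  obtain ⟨C, hC, hs, he⟩ :=
    (Summit.PneNP.PneNP.Theorems.LinAlgGateBlind.Negative.cktSize_shadow_of_hasDetRepr
      (Summit.PneNP.PneNP.Theorems.LinAlgGateBlind.Negative.hasDetRepr_cliquePoly (m := m) (F := ℚ) k)
      fun i => (CliqueLPGate.eE m).symm i).toCircuit
  refine ⟨C, hC, hs, fun x => ?_⟩
  rw [he x]
  apply Bool.eq_iff_iff.2
  rw [decide_eq_true_iff,
    Summit.PneNP.PneNP.Theorems.LinAlgGateBlind.Negative.shadow_cliquePoly_iff hk]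

/-- GRANK gates of unrestricted dimension. -/
def GRankAnyDim (g : GateFn) : Prop := ∃ t, IsGRankGate t g

/-- The linear basis with the dimension bound dropped from GRANK (SPAN keeps `p, D ≤ s`). -/
def linBasisNoGRankDim (s : ℕ) : Set GateFn :=
  {GateFn.and 2, GateFn.or 2} ∪ {g | IsSpanGate s g ∨ GRankAnyDim g}

/-- Stub D WITHOUT the dimension bound on its GRANK gates. -/
def LinBlindWithoutGRankDim : Prop := ∃ δ : ℝ, 0 < δ ∧ δ < 1 / 2 ∧ BlindFor linBasisNoGRankDim δ

/-- **Stub D needs its GRANK dimension bound** (the Valiant calibration is inherited verbatim). -/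
theorem not_linBlindWithoutGRankDim : ¬ LinBlindWithoutGRankDim := by
  rintro ⟨δ, hδ0, -, h⟩
  obtain ⟨m, hm, hm2⟩ := ((h 0).and (eventually_ge_atTop 2)).exists
  obtain ⟨C, hC, hs, hc⟩ := exists_oneGRankGate_computes_cliqueFn m (kOf δ m) (two_le_kOf hδ0 hm2)
  refine hm C (hC.mono fun g hg => Or.inr (Or.inr ⟨_, hg⟩)) (hs.trans ?_) hc
  simp

/-! ## Sanity II: `SPAN_s ⊆ PERM_{s·s}` — stub D is IMPLIED by the crux, so modulo stubs A–C the line is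
an EQUIVALENCE (`linAlgGateBlind_iff_linBlind`)

The additive group `(ℤ/q)^D` acts faithfully on the `D · q` points `Fin D × ℤ/q` by coordinate-wise
translation (`D` disjoint `q`-cycles); span over `ℤ/q` = generated additive subgroup
(`AddSubgroup.toZModSubmodule`), transported through the faithful action (`Subgroup.mem_map_iff_mem`). -/

section SpanIsPerm

variable {q D : ℕ}

/-- Coordinate-wise translation of `Fin D × ZMod q` by a vector of `(ZMod q)^D`, as a monoid hom from
the multiplicative copy of the additive group. -/
def shiftHom (q D : ℕ) : Multiplicative (Fin D → ZMod q) →* Equiv.Perm (Fin D × ZMod q) where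
  toFun u :=
    { toFun := fun x => (x.1, x.2 + Multiplicative.toAdd u x.1)
      invFun := fun x => (x.1, x.2 - Multiplicative.toAdd u x.1)
      left_inv := fun x => by simp
      right_inv := fun x => by simp }
  map_one' := by
    ext x <;> simp
  map_mul' u u' := by
    ext x <;> simp [add_comm, add_left_comm]

theorem shiftHom_apply (u : Multiplicative (Fin D → ZMod q)) (x : Fin D × ZMod q) :
    shiftHom q D u x = (x.1, x.2 + Multiplicative.toAdd u x.1) := rfl

theorem shiftHom_injective : Function.Injective (shiftHom q D) := by
  intro u u' h
  refine Multiplicative.toAdd.injective (funext fun j => ?_)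
  have := congrArg (fun σ : Equiv.Perm (Fin D × ZMod q) => (σ (j, 0)).2) h
  simpa [shiftHom_apply] using this

/-- Span over `ℤ/q` is the generated additive subgroup. -/
theorem mem_span_zmod_iff_mem_closure {M : Type*} [AddCommGroup M] [Module (ZMod q) M]
    (Y : Set M) (t : M) : t ∈ Submodule.span (ZMod q) Y ↔ t ∈ AddSubgroup.closure Y := by
  constructor
  · intro ht
    have hle : Submodule.span (ZMod q) Y ≤ AddSubgroup.toZModSubmodule q (AddSubgroup.closure Y) :=
      Submodule.span_le.2 (fun y hy => AddSubgroup.subset_closure hy)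
    exact (AddSubgroup.mem_toZModSubmodule q).1 (hle ht)
  · intro ht
    exact (AddSubgroup.closure_le ((Submodule.span (ZMod q) Y).toAddSubgroup)).2
      (fun y hy => Submodule.subset_span hy) ht

/-- Transport of "target in the span of the selected vectors" to "target permutation in the group
generated by the selected permutations" along the faithful translation action. -/
theorem mem_span_iff_shiftHom_mem_closure {n : ℕ} (w : Fin n → Fin D → ZMod q) (t : Fin D → ZMod q)
    (S : Set (Fin n)) :
    t ∈ Submodule.span (ZMod q) (w '' S) ↔
      shiftHom q D (Multiplicative.ofAdd t) ∈
        Subgroup.closure ((fun i => shiftHom q D (Multiplicative.ofAdd (w i))) '' S) := by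
  rw [mem_span_zmod_iff_mem_closure]
  have hset : (fun i => shiftHom q D (Multiplicative.ofAdd (w i))) '' S =
      shiftHom q D '' (Multiplicative.toAdd ⁻¹' (w '' S)) := by
    ext σ
    simp only [Set.mem_image, Set.mem_preimage]
    constructor
    · rintro ⟨i, hi, rfl⟩
      exact ⟨Multiplicative.ofAdd (w i), ⟨i, hi, by simp⟩, rfl⟩
    · rintro ⟨u, ⟨i, hi, hu⟩, rfl⟩
      exact ⟨i, hi, by rw [hu]; rfl⟩
  rw [hset, ← MonoidHom.map_closure, Subgroup.mem_map_iff_mem shiftHom_injective,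
    ← AddSubgroup.toSubgroup_closure]
  rfl

/-- **`SPAN_s ⊆ PERM_{s·s}`.** -/
theorem IsSpanGate.isPermGate {s : ℕ} {g : GateFn} (h : IsSpanGate s g) : IsPermGate (s * s) g := by
  obtain ⟨q, D, hq, hqs, hDs, w, t, hg⟩ := h
  haveI : NeZero q := ⟨by omega⟩
  have hcard : Fintype.card (Fin D × ZMod q) ≤ s * s := by
    rw [Fintype.card_prod, Fintype.card_fin, ZMod.card]
    exact Nat.mul_le_mul hDs hqs
  exact Summit.PneNP.PneNP.Theorems.LinAlgGateBlind.Negative.isPermGate_of_fintype hcard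
    (fun i => shiftHom q D (Multiplicative.ofAdd (w i))) (shiftHom q D (Multiplicative.ofAdd t)) g.2
    fun v => (hg v).trans (mem_span_iff_shiftHom_mem_closure w t {i | v i = true})

end SpanIsPerm

/-- `linBasis s ⊆ basis (s · s)`. -/
theorem linBasis_subset_basis_mul (s : ℕ) : linBasis s ⊆ basis (s * s) := by
  rintro g (hg | hg | hg)
  · exact Or.inl hg
  · exact Or.inr (Or.inl hg.isPermGate)
  · exact Or.inr (Or.inr (hg.mono (Nat.le_mul_self s)))

/-- **Stub D is implied by the crux** (`c ↦ 2c`). -/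
theorem linBlind_of_linAlgGateBlind (h : Summit.PneNP.PneNP.Theses.ConvexRankGates.LinAlgGateBlind) :
    LinBlind := by
  obtain ⟨δ, hδ0, hδ1, hB⟩ := linAlgGateBlind_iff.1 h
  refine ⟨δ, hδ0, hδ1, fun c => ?_⟩
  filter_upwards [hB (2 * c), eventually_ge_atTop 1] with m hm h1 C hC hsize
  refine hm C (hC.mono ?_) (hsize.trans (Nat.pow_le_pow_right h1 (by omega)))
  rw [show m ^ (2 * c) = m ^ c * m ^ c by ring]
  exact linBasis_subset_basis_mul _

/-- **The line is an equivalence modulo its first three stubs**: given the Linearisation Conjecture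
and the two provable-now reductions, the crux IS the blindness of the linear basis. -/
theorem linAlgGateBlind_iff_linBlind (hA : Registered.stub_linearisation) (hB : Registered.stub_spanTests)
    (hC : Registered.stub_permElimination) :
    Summit.PneNP.PneNP.Theses.ConvexRankGates.LinAlgGateBlind ↔ LinBlind :=
  ⟨linBlind_of_linAlgGateBlind, fun hD => LinAlgGateBlind_of hA hB hC hD⟩

end Summit.PneNP.PneNP.Cruxes.LinAlgGateBlind.InvariantModuleLinearisation
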